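import Mathlib
import Summits.Ventures.PercRepro2.SwOutCrossGenSumIneq

/-!
# The minimal fibre record: the five data fields and the inequality (blind cell PercRepro2,
night-4 g25, 2026-08-28; proofs/NIGHT4-G25.md §3)

The geometry of the cross base (`SwOutCrossBase*`) reads the abstract fibre only through its
DATA — the flip, the red atoms, the red-side leak, the label and its order — and through the
INEQUALITY of its cube.  `FibreMin` is that record; `FibreData.toMin` and `FibreIter.toMin`
forget to it, and the cube notions `LeakM`, `ERM`, `EBM`, `typM`, `BetterM`, `IsUpM`, `QM` and
the inequality `IneqM` are the generic ones restated for it (definitionally the same, so that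
`ineqM_of_ineq` and `ineqM_of_fibreData` are the identity).  **`fibKEEMin G`** is the record of
the `KE` fields for ANY cross graph `G` — no connectivity — and its inequality is supplied by the
abstract theorems: `ineqM_fibKEE` for a connected `G` (`card_le_crossKEE`) and
**`ineqM_fibKEESum₂`** for the disjoint union of two connected components (`ineq_fibKEESum₂`,
the joint order).  With the far layer `SwOutCrossGenFarM` over `FibreMin`, the geometric block
theorem of the cross base becomes a theorem for every `G` whose `fibKEEMin G` has the inequality.
-/

namespace Summit.Ventures.PercRepro2

namespace CrossArm

/-- **The minimal fibre record**: the data fields the geometry reads. -/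
structure FibreMin (W A L : Type*) where
  /-- the flip of a fibre point -/
  flip : W → W
  /-- the red fibre atoms of a point, when `u` is red -/
  red : W → A → Bool
  /-- the red-side leak of a point -/
  leakR : W → Bool
  /-- the label of a point -/
  label : W → L
  /-- `BetterL l' l`: `l'` is at least as good a label as `l` -/
  BetterL : L → L → Prop
  /-- `BetterL` is reflexive -/
  betterL_refl : ∀ l, BetterL l l

section ToMin

variable {W A L : Type*}

/-- A `FibreData` forgets to its record. -/
def FibreData.toMin (F : FibreData W A L) : FibreMin W A L :=
  ⟨F.flip, F.red, F.leakR, F.label, F.BetterL, F.betterL_refl⟩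

/-- A `FibreIter` forgets to its record. -/
def FibreIter.toMin (F : FibreIter W A L) : FibreMin W A L :=
  ⟨F.flip, F.red, F.leakR, F.label, F.BetterL, F.betterL_refl⟩

end ToMin

section Cube

variable {W A L : Type*} {ι : Type*} (F : FibreMin W A L)

/-- The leak of a point. -/
def LeakM (q : PtG W ι) : Prop :=
  (redUG q.1 ∧ F.leakR q.2 = true) ∨ (blueUG q.1 ∧ F.leakR (F.flip q.2) = true)

/-- The red atoms of a point. -/
def ERM (q : PtG W ι) : Set (AtomG A ι) := fun a =>
  match a with
  | Sum.inl j => q.1 j = true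
  | Sum.inr (Sum.inl _) => redUG q.1
  | Sum.inr (Sum.inr a) => redUG q.1 ∧ F.red q.2 a = true

/-- The total flip of a point. -/
def flipM (q : PtG W ι) : PtG W ι := (flipAll q.1, F.flip q.2)

/-- The blue atoms: the red atoms of the flip. -/
def EBM (q : PtG W ι) : Set (AtomG A ι) := ERM F (flipM F q)

/-- The type of a point. -/
def typM (q : PtG W ι) : TypG L ι := (q.1, F.label q.2)

/-- `t'` is at least as good a type as `t`. -/
def BetterM (t' t : TypG L ι) : Prop :=
  (∀ j, t.1 j = false → t'.1 j = false) ∧ F.BetterL t'.2 t.2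

/-- An up-set of types. -/
def IsUpM (𝒯 : Set (TypG L ι)) : Prop := ∀ t ∈ 𝒯, ∀ t', BetterM F t' t → t' ∈ 𝒯

variable [Fintype ι] [DecidableEq ι] [Fintype W] [DecidableEq W]

open scoped Classical in
/-- The non-leaking points whose type lies in `𝒯`. -/
noncomputable def QM (𝒯 : Set (TypG L ι)) : Finset (PtG W ι) :=
  Finset.univ.filter fun q => ¬ LeakM F q ∧ typM F q ∈ 𝒯

open scoped Classical in
/-- **The inequality on the cube over `ι`.** -/
def IneqM : Prop :=
  ∀ (𝒯 : Set (TypG L ι)) (𝓔 : Set (Set (AtomG A ι))), IsUpM F 𝒯 → IsUpperSet 𝓔 →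
    ((QM F 𝒯).filter fun q => ERM F q ∈ 𝓔).card ≤ ((QM F 𝒯).filter fun q => EBM F q ∈ 𝓔).card

omit [DecidableEq W] in
open scoped Classical in
/-- Membership in `QM`. -/
lemma mem_QM {𝒯 : Set (TypG L ι)} {q : PtG W ι} : q ∈ QM F 𝒯 ↔ ¬ LeakM F q ∧ typM F q ∈ 𝒯 := by
  simp only [QM, Finset.mem_filter, Finset.mem_univ, true_and]

omit [DecidableEq W] in
/-- The inequality of a `FibreIter` is the inequality of its record. -/
lemma ineqM_of_ineq (F : FibreIter W A L) (h : Ineq F (ι := ι)) : IneqM F.toMin (ι := ι) :=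
  fun 𝒯 𝓔 h𝒯 h𝓔 => h 𝒯 𝓔 h𝒯 h𝓔

variable [Nonempty ι]

/-- The inequality of a `FibreData` is the inequality of its record. -/
lemma ineqM_of_fibreData (F : FibreData W A L) : IneqM F.toMin (ι := ι) :=
  fun _ _ h𝒯 h𝓔 => card_le_crossGen (F := F) h𝒯 h𝓔

end Cube

section KE

open Classical

variable {X : Type*} (G : SimpleGraph X)

/-- **The `KE` record of any cross graph**: the flip, the red edge atoms, the red-side leak, the
label and its order — no connectivity. -/
noncomputable def fibKEEMin : FibreMin (FibKE X G) (AtomKEE X G) (LabelKE X) :=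
  ⟨FibKE.flip, redKEE G, leakKE G, labelKE G, BetterKE, BetterKE_refl⟩

variable [Fintype X] [DecidableEq X] [DecidableRel G.Adj] [Nonempty X]
  {ι : Type*} [Fintype ι] [DecidableEq ι] [Nonempty ι]

/-- The record of a connected component has the inequality (`card_le_crossKEE`). -/
theorem ineqM_fibKEE (hG : G.Connected) : IneqM (fibKEEMin G) (ι := ι) :=
  ineqM_of_fibreData (fibKEE G hG)

end KE

section KESum

open Classical

variable {X₁ X₂ : Type*} (G₁ : SimpleGraph X₁) (G₂ : SimpleGraph X₂)
  [Fintype X₁] [DecidableEq X₁] [DecidableRel G₁.Adj] [Nonempty X₁] (hG₁ : G₁.Connected)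
  [Fintype X₂] [DecidableEq X₂] [DecidableRel G₂.Adj] [Nonempty X₂] (hG₂ : G₂.Connected)
  {ι : Type*} [Fintype ι] [DecidableEq ι] [Nonempty ι]

include hG₁ hG₂ in
/-- **The record of the disjoint union of two connected components has the inequality**
(`ineq_fibKEESum₂`, the joint order). -/
theorem ineqM_fibKEESum₂ : IneqM (fibKEEMin (G₁ ⊕g G₂)) (ι := ι) :=
  ineqM_of_ineq (fibKEESum₂ G₁ G₂ hG₁) (ineq_fibKEESum₂ G₁ G₂ hG₁ hG₂)

end KESum

end CrossArm

end Summit.Ventures.PercRepro2
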